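import Literature.NumberTheory.LFunctions.Bettin2017AbelExpSum
import Literature.NumberTheory.LFunctions.Bettin2017BesselWeightVariation
import Literature.NumberTheory.LFunctions.KloostermanPrimePower
import HarnessLib

/-!
# The opened Kloosterman sum against the Bessel–exponential weight:
# `‖Σ_n n^{-1/2} e^{-2πny} J₁(4π√(mn)/c) S(m,n;c)‖ ≤ 2π(3 + 2Λ(y))(1 + log c)√m`

Topic `Literature/NumberTheory/LFunctions` (cell landau-siegel / ls-inputs, input I2 =
`bettin2017_theorem11_primeLevel`, line `hecke_afe_petersson`, stub S4 `stub_offDiagonal`).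

This is the `q = 1`, `α = 0` case of Bettin 2017, §2 (2.5) + §4 (4.3): open
`S(m,n;c) = Σ*_x e((mx + n x̄)/c)` (the tree's `kloostermanSum`), exchange with the absolutely
convergent `n`-sum, and bound each `T(x̄, c) = Σ_n e(n x̄/c) g(n)`,
`g(n) = n^{-1/2} e^{-2πny} J₁(4π√(mn)/c)`, by Abel summation
(`norm_tsum_mul_le_of_norm_sum_le`) against the geometric sum `‖Σ_{n<k} e(na/c)‖ ≤ c/(2 min(a, c−a))`
(`norm_sum_range_exp_le`, `inv_abs_sin_pi_div_le`) with the variation bound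
`Σ|g(n+1) − g(n)| ≤ 2π(3 + 2Λ(y))√m/c` (`summable_abs_besselWeight_sub`); summing
`1/min(a, c−a)` over the units (`sum_inv_min_le`) gives the factor `2(1 + log c)`. In Bettin's
notation this is `Σ*_a e(ma/c) T_m(a,c;Y) ≪ m^{1/2}(cY)^ε` ((4.3) at `q = T = 1`), with the
`ε`-losses replaced by the explicit logarithms `Λ(y) = −log(1 − e^{−2πy})` (`y = 1/Y`) and `log c`.
Everything is proved; no definition, no named fact.
-/

noncomputable section

open scoped Real
open Complex Finset Filter Topology
open Literature.Analysis.FunctionSpaces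

namespace Literature.NumberTheory.LFunctions.Bettin2017

variable {c : ℕ} [NeZero c]

/-- The standard additive character as an exponential: `ψ(u) = e(u.val/c)`. [folklore] -/
private theorem stdAddChar_eq_exp (u : ZMod c) :
    (ZMod.stdAddChar u : ℂ) = Complex.exp (2 * π * I * (((u.val : ℝ) / (c : ℝ) : ℝ) : ℂ)) := by
  have hu : u = ((u.val : ℤ) : ZMod c) := by
    rw [Int.cast_natCast, ZMod.natCast_zmod_val]
  conv_lhs => rw [hu]
  rw [ZMod.stdAddChar_coe]
  congr 1
  push_cast
  ring

/-- Opening one term of the Kloosterman sum against `n`: `ψ(mx + n x⁻¹) = ψ(mx) · ψ(x⁻¹)^n`.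
[folklore] -/
private theorem stdAddChar_mul_add_natCast_mul (m n : ℕ) (x : ZMod c) :
    (ZMod.stdAddChar ((m : ZMod c) * x + (n : ZMod c) * x⁻¹) : ℂ) =
      ZMod.stdAddChar ((m : ZMod c) * x) * (ZMod.stdAddChar x⁻¹) ^ n := by
  rw [AddChar.map_add_eq_mul]
  congr 1
  rw [← nsmul_eq_mul, AddChar.map_nsmul_eq_pow]

/-- `ψ(u)^n = e(n · u.val/c)` in the shape of `norm_sum_range_exp_le`. [folklore] -/
private theorem stdAddChar_pow_eq (u : ZMod c) (n : ℕ) :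
    (ZMod.stdAddChar u : ℂ) ^ n =
      Complex.exp (2 * π * I * (((u.val : ℝ) / (c : ℝ) : ℝ) : ℂ) * n) := by
  rw [stdAddChar_eq_exp, ← Complex.exp_nat_mul]
  congr 1
  ring

/-- For a unit `x` of `ZMod c`, `c ≥ 2`: `x⁻¹` is non-zero, so `0 < (x⁻¹).val < c`. [folklore] -/
private theorem val_inv_pos_of_isUnit (hc : 2 ≤ c) {x : ZMod c} (hx : IsUnit x) :
    0 < (x⁻¹).val ∧ (x⁻¹).val < c := by
  haveI : Fact (1 < c) := ⟨by omega⟩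
  obtain ⟨u, rfl⟩ := hx
  refine ⟨Nat.pos_of_ne_zero fun h ↦ ?_, ZMod.val_lt _⟩
  rw [ZMod.inv_coe_unit, ZMod.val_eq_zero] at h
  exact Units.ne_zero u⁻¹ h

/-- **Partial sums of the character against a unit**: for a unit `x` of `ZMod c` (`c ≥ 2`) and
every `k`, `‖Σ_{n<k} ψ(x⁻¹)^n‖ ≤ c/(2 min(a, c−a))`, `a = (x⁻¹).val` (geometric sum + Jordan).
[cite: IwaniecKowalski2004, §8.2 (8.6)] -/
theorem norm_sum_range_stdAddChar_inv_pow_le (hc : 2 ≤ c) {x : ZMod c} (hx : IsUnit x) (k : ℕ) :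
    ‖∑ n ∈ range k, (ZMod.stdAddChar x⁻¹ : ℂ) ^ n‖ ≤
      (c : ℝ) / (2 * ((min (x⁻¹).val (c - (x⁻¹).val) : ℕ) : ℝ)) := by
  obtain ⟨ha0, hac⟩ := val_inv_pos_of_isUnit hc hx
  have hsin : Real.sin (π * (((x⁻¹).val : ℝ) / c)) ≠ 0 := by
    have h := abs_sin_pi_div_ge ha0 hac
    have hpos : 0 < 2 * ((min (x⁻¹).val (c - (x⁻¹).val) : ℕ) : ℝ) / c := by
      have : 0 < min (x⁻¹).val (c - (x⁻¹).val) := lt_min ha0 (by omega)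
      have hc0 : (0 : ℝ) < c := by exact_mod_cast (lt_trans ha0 hac)
      positivity
    intro h0
    rw [h0, abs_zero] at h
    linarith
  simp_rw [stdAddChar_pow_eq]
  exact (norm_sum_range_exp_le hsin k).trans (inv_abs_sin_pi_div_le ha0 hac)

/-- **One unit's contribution**: for a unit `x` of `ZMod c` (`c ≥ 2`), `m ≥ 1`, `y > 0`,
`‖Σ_n ψ(x⁻¹)^n g(n)‖ ≤ π(3 + 2Λ(y))√m / min(a, c−a)`, `a = (x⁻¹).val`,
`g(n) = n^{-1/2}e^{-2πny}J₁(4π√(mn)/c)` — Abel summation (Bettin §4, the bound for `T_m(a,c;Y)`).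
[cite: Bettin2017, §4 (4.3) (case q = 1, α = 0)] -/
theorem norm_tsum_stdAddChar_pow_mul_besselWeight_le (hc : 2 ≤ c) {x : ZMod c} (hx : IsUnit x)
    {m : ℕ} (hm : 1 ≤ m) {y : ℝ} (hy : 0 < y) :
    ‖∑' n : ℕ, (ZMod.stdAddChar x⁻¹ : ℂ) ^ n *
        (((n : ℝ) ^ (-(1 / 2 : ℝ)) * Real.exp (-(2 * π * n) * y) *
          besselJ 1 (4 * π * Real.sqrt ((m : ℝ) * n) / c) : ℝ) : ℂ)‖ ≤
      π * (3 + 2 * (-Real.log (1 - Real.exp (-(2 * π * y))))) * Real.sqrt m /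
        ((min (x⁻¹).val (c - (x⁻¹).val) : ℕ) : ℝ) := by
  have hc0 : (0 : ℝ) < c := by exact_mod_cast (show 0 < c by omega)
  obtain ⟨ha0, hac⟩ := val_inv_pos_of_isUnit hc hx
  have hmin0 : (0 : ℝ) < ((min (x⁻¹).val (c - (x⁻¹).val) : ℕ) : ℝ) := by
    have : 0 < min (x⁻¹).val (c - (x⁻¹).val) := lt_min ha0 (by omega)
    exact_mod_cast this
  set g : ℕ → ℂ := fun n ↦ (((n : ℝ) ^ (-(1 / 2 : ℝ)) * Real.exp (-(2 * π * n) * y) *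
    besselJ 1 (4 * π * Real.sqrt ((m : ℝ) * n) / c) : ℝ) : ℂ) with hg
  -- the inputs of Abel's inequality
  have hA := norm_sum_range_stdAddChar_inv_pow_le hc hx
  obtain ⟨hVs, hVle⟩ := summable_abs_besselWeight_sub hm hc0 hy
  have hnormsub : ∀ n : ℕ, ‖g (n + 1) - g n‖ =
      |((n + 1 : ℕ) : ℝ) ^ (-(1 / 2 : ℝ)) * Real.exp (-(2 * π * ((n + 1 : ℕ) : ℝ)) * y) *
            besselJ 1 (4 * π * Real.sqrt ((m : ℝ) * ((n + 1 : ℕ) : ℝ)) / c) -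
          (n : ℝ) ^ (-(1 / 2 : ℝ)) * Real.exp (-(2 * π * n) * y) *
            besselJ 1 (4 * π * Real.sqrt ((m : ℝ) * n) / c)| := by
    intro n
    simp only [hg, ← Complex.ofReal_sub, Complex.norm_real, Real.norm_eq_abs]
  have hV : Summable fun n ↦ ‖g (n + 1) - g n‖ := by
    refine hVs.congr fun n ↦ ?_
    rw [hnormsub]
  have hVeq : ∑' n, ‖g (n + 1) - g n‖ =
      ∑' n : ℕ, |((n + 1 : ℕ) : ℝ) ^ (-(1 / 2 : ℝ)) * Real.exp (-(2 * π * ((n + 1 : ℕ) : ℝ)) * y) *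
            besselJ 1 (4 * π * Real.sqrt ((m : ℝ) * ((n + 1 : ℕ) : ℝ)) / c) -
          (n : ℝ) ^ (-(1 / 2 : ℝ)) * Real.exp (-(2 * π * n) * y) *
            besselJ 1 (4 * π * Real.sqrt ((m : ℝ) * n) / c)| :=
    tsum_congr hnormsub
  have hg0 : Tendsto g atTop (𝓝 0) := by
    have h := tendsto_besselWeight m hc0 hy
    rw [show (0 : ℂ) = ((0 : ℝ) : ℂ) from Complex.ofReal_zero.symm]
    exact (Complex.continuous_ofReal.tendsto 0).comp h
  -- absolute summability of `ψ^n g(n)`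
  have hgb : ∀ n, ‖g n‖ ≤ 2 * π * Real.sqrt m / c * Real.exp (-(2 * π * n) * y) := by
    intro n
    simp only [hg, Complex.norm_real, Real.norm_eq_abs]
    exact abs_besselWeight_le m hc0 y n
  have hgeom : Summable fun n : ℕ ↦ 2 * π * Real.sqrt m / c * Real.exp (-(2 * π * n) * y) := by
    have hx1 : Real.exp (-(2 * π * y)) < 1 := by
      rw [← Real.exp_zero]; exact Real.exp_lt_exp.mpr (by nlinarith [Real.pi_pos])
    refine ((summable_geometric_of_lt_one (Real.exp_pos _).le hx1).mul_left
      (2 * π * Real.sqrt m / c)).congr fun n ↦ ?_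
    rw [← Real.exp_nat_mul]; congr 1; ring
  have hs : Summable fun n ↦ (ZMod.stdAddChar x⁻¹ : ℂ) ^ n * g n := by
    refine Summable.of_norm_bounded hgeom fun n ↦ ?_
    rw [norm_mul, norm_pow, norm_stdAddChar, one_pow, one_mul]
    exact hgb n
  -- Abel
  have key := norm_tsum_mul_le_of_norm_sum_le hA hg0 hV hs
  rw [hVeq] at key
  refine key.trans ?_
  calc (c : ℝ) / (2 * ((min (x⁻¹).val (c - (x⁻¹).val) : ℕ) : ℝ)) *
        ∑' n : ℕ, |((n + 1 : ℕ) : ℝ) ^ (-(1 / 2 : ℝ)) * Real.exp (-(2 * π * ((n + 1 : ℕ) : ℝ)) * y) *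
            besselJ 1 (4 * π * Real.sqrt ((m : ℝ) * ((n + 1 : ℕ) : ℝ)) / c) -
          (n : ℝ) ^ (-(1 / 2 : ℝ)) * Real.exp (-(2 * π * n) * y) *
            besselJ 1 (4 * π * Real.sqrt ((m : ℝ) * n) / c)|
      ≤ (c : ℝ) / (2 * ((min (x⁻¹).val (c - (x⁻¹).val) : ℕ) : ℝ)) *
          (2 * π * (3 + 2 * (-Real.log (1 - Real.exp (-(2 * π * y))))) * Real.sqrt m / c) := by
        gcongr
    _ = π * (3 + 2 * (-Real.log (1 - Real.exp (-(2 * π * y))))) * Real.sqrt m /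
          ((min (x⁻¹).val (c - (x⁻¹).val) : ℕ) : ℝ) := by
        field_simp

/-- The sum of `1/min(a_x, c−a_x)`, `a_x = (x⁻¹).val`, over any set of units `x` of `ZMod c` is at
most `Σ_{a=1}^{c−1} 1/min(a, c−a) ≤ 2(1 + log c)` (`x ↦ (x⁻¹).val` is injective on units).
[cite: Apostol1976, Thm. 3.2 (a)] -/
theorem sum_units_inv_min_le (hc : 2 ≤ c) {U : Finset (ZMod c)} (hU : ∀ x ∈ U, IsUnit x) :
    ∑ x ∈ U, (((min (x⁻¹).val (c - (x⁻¹).val) : ℕ) : ℝ))⁻¹ ≤ 2 * (1 + Real.log c) := by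
  classical
  have hinj : Set.InjOn (fun x : ZMod c ↦ (x⁻¹).val) U := by
    intro x hx x' hx' h
    obtain ⟨u, rfl⟩ := hU x hx
    obtain ⟨u', rfl⟩ := hU x' hx'
    have h' : ((u⁻¹ : (ZMod c)ˣ) : ZMod c) = ((u'⁻¹ : (ZMod c)ˣ) : ZMod c) := by
      have h1 : ((u : ZMod c)⁻¹).val = ((u' : ZMod c)⁻¹).val := h
      rw [ZMod.inv_coe_unit, ZMod.inv_coe_unit] at h1
      exact ZMod.val_injective c h1
    have h2 : (u⁻¹ : (ZMod c)ˣ) = u'⁻¹ := Units.ext h'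
    rw [inv_inj.mp h2]
  have himg : U.image (fun x : ZMod c ↦ (x⁻¹).val) ⊆ Ico 1 c := by
    intro a ha
    rw [Finset.mem_image] at ha
    obtain ⟨x, hx, rfl⟩ := ha
    obtain ⟨h0, h1⟩ := val_inv_pos_of_isUnit hc (hU x hx)
    rw [mem_Ico]; exact ⟨h0, h1⟩
  have hf0 : ∀ a ∈ Ico 1 c, a ∉ U.image (fun x : ZMod c ↦ (x⁻¹).val) →
      0 ≤ (((min a (c - a) : ℕ) : ℝ))⁻¹ := fun a _ _ ↦ by positivity
  calc ∑ x ∈ U, (((min (x⁻¹).val (c - (x⁻¹).val) : ℕ) : ℝ))⁻¹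
      = ∑ a ∈ U.image (fun x : ZMod c ↦ (x⁻¹).val), (((min a (c - a) : ℕ) : ℝ))⁻¹ :=
        (Finset.sum_image (f := fun a : ℕ ↦ (((min a (c - a) : ℕ) : ℝ))⁻¹) hinj).symm
    _ ≤ ∑ a ∈ Ico 1 c, (((min a (c - a) : ℕ) : ℝ))⁻¹ :=
        Finset.sum_le_sum_of_subset_of_nonneg himg hf0
    _ ≤ 2 * (1 + Real.log c) := sum_inv_min_le c

/-- **The opened Kloosterman sum against the weight** (Bettin 2017, (2.5) + (4.3) at `q = 1`,
`α = 0`, with logarithms in place of `ε`'s): for `c ≥ 2`, `m ≥ 1`, `y > 0`,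
`‖Σ_n n^{-1/2} e^{-2πny} J₁(4π√(mn)/c) S(m,n;c)‖ ≤ 2π (3 + 2Λ(y)) (1 + log c) √m`,
`Λ(y) = −log(1 − e^{−2πy})`, `S` the tree's `kloostermanSum`.
[cite: Bettin2017, §2 (2.5) and §4 (4.3) (case q = 1, α = 0)] -/
theorem norm_tsum_besselWeight_mul_kloostermanSum_le (hc : 2 ≤ c) {m : ℕ} (hm : 1 ≤ m)
    {y : ℝ} (hy : 0 < y) :
    ‖∑' n : ℕ, (((n : ℝ) ^ (-(1 / 2 : ℝ)) * Real.exp (-(2 * π * n) * y) *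
          besselJ 1 (4 * π * Real.sqrt ((m : ℝ) * n) / c) : ℝ) : ℂ) *
        kloostermanSum c (m : ZMod c) (n : ZMod c)‖ ≤
      2 * π * (3 + 2 * (-Real.log (1 - Real.exp (-(2 * π * y))))) * (1 + Real.log c) *
        Real.sqrt m := by
  classical
  have hc0 : (0 : ℝ) < c := by exact_mod_cast (show 0 < c by omega)
  set Λ := -Real.log (1 - Real.exp (-(2 * π * y))) with hΛ
  have hΛ0 : 0 ≤ Λ := by
    rw [hΛ, neg_nonneg]
    have he0 : 0 < Real.exp (-(2 * π * y)) := Real.exp_pos _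
    have he1 : Real.exp (-(2 * π * y)) < 1 := by
      rw [← Real.exp_zero]; exact Real.exp_lt_exp.mpr (by nlinarith [Real.pi_pos])
    exact Real.log_nonpos (by linarith) (by linarith)
  set g : ℕ → ℂ := fun n ↦ (((n : ℝ) ^ (-(1 / 2 : ℝ)) * Real.exp (-(2 * π * n) * y) *
    besselJ 1 (4 * π * Real.sqrt ((m : ℝ) * n) / c) : ℝ) : ℂ) with hg
  -- each opened term is absolutely summable in `n`
  have hgb : ∀ n, ‖g n‖ ≤ 2 * π * Real.sqrt m / c * Real.exp (-(2 * π * n) * y) := by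
    intro n
    simp only [hg, Complex.norm_real, Real.norm_eq_abs]
    exact abs_besselWeight_le m hc0 y n
  have hgeom : Summable fun n : ℕ ↦ 2 * π * Real.sqrt m / c * Real.exp (-(2 * π * n) * y) := by
    have hx1 : Real.exp (-(2 * π * y)) < 1 := by
      rw [← Real.exp_zero]; exact Real.exp_lt_exp.mpr (by nlinarith [Real.pi_pos])
    refine ((summable_geometric_of_lt_one (Real.exp_pos _).le hx1).mul_left
      (2 * π * Real.sqrt m / c)).congr fun n ↦ ?_
    rw [← Real.exp_nat_mul]; congr 1; ring
  have hsumx : ∀ x : ZMod c, Summable fun n : ℕ ↦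
      (ZMod.stdAddChar ((m : ZMod c) * x) : ℂ) * ((ZMod.stdAddChar x⁻¹ : ℂ) ^ n * g n) := by
    intro x
    have h1 : Summable fun n : ℕ ↦ (ZMod.stdAddChar x⁻¹ : ℂ) ^ n * g n := by
      refine Summable.of_norm_bounded hgeom fun n ↦ ?_
      rw [norm_mul, norm_pow, norm_stdAddChar, one_pow, one_mul]
      exact hgb n
    exact h1.mul_left ((ZMod.stdAddChar ((m : ZMod c) * x) : ℂ))
  -- the unit part of `ZMod c` as a Finset, and the opened sum
  obtain ⟨U, hU⟩ : ∃ U : Finset (ZMod c), U = Finset.univ.filter (fun x : ZMod c ↦ IsUnit x) :=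
    ⟨_, rfl⟩
  have hUmem : ∀ x ∈ U, IsUnit x := fun x hx ↦ by
    rw [hU] at hx
    exact (Finset.mem_filter.mp hx).2
  have hopen : ∀ n : ℕ, g n * kloostermanSum c (m : ZMod c) (n : ZMod c) =
      ∑ x ∈ U, (ZMod.stdAddChar ((m : ZMod c) * x) : ℂ) * ((ZMod.stdAddChar x⁻¹ : ℂ) ^ n * g n) := by
    intro n
    rw [kloostermanSum, Finset.mul_sum, hU, Finset.sum_filter]
    refine Finset.sum_congr rfl fun x _ ↦ ?_
    split_ifs with hx
    · rw [stdAddChar_mul_add_natCast_mul]; ring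
    · rw [mul_zero]
  have hswap : ∑' n : ℕ, g n * kloostermanSum c (m : ZMod c) (n : ZMod c) =
      ∑ x ∈ U, ∑' n : ℕ,
        (ZMod.stdAddChar ((m : ZMod c) * x) : ℂ) * ((ZMod.stdAddChar x⁻¹ : ℂ) ^ n * g n) := by
    rw [tsum_congr hopen]
    exact Summable.tsum_finsetSum fun x _ ↦ hsumx x
  rw [hswap]
  -- bound each unit's term
  have hterm : ∀ x ∈ U,
      ‖∑' n : ℕ, (ZMod.stdAddChar ((m : ZMod c) * x) : ℂ) * ((ZMod.stdAddChar x⁻¹ : ℂ) ^ n * g n)‖ ≤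
        (((min (x⁻¹).val (c - (x⁻¹).val) : ℕ) : ℝ))⁻¹ * (π * (3 + 2 * Λ) * Real.sqrt m) := by
    intro x hx
    rw [tsum_mul_left, norm_mul, norm_stdAddChar, one_mul]
    have h := norm_tsum_stdAddChar_pow_mul_besselWeight_le hc (hUmem x hx) hm hy
    rw [← hΛ] at h
    refine h.trans (le_of_eq ?_)
    rw [div_eq_inv_mul]
  calc ‖∑ x ∈ U, ∑' n : ℕ,
          (ZMod.stdAddChar ((m : ZMod c) * x) : ℂ) * ((ZMod.stdAddChar x⁻¹ : ℂ) ^ n * g n)‖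
      ≤ ∑ x ∈ U, ‖∑' n : ℕ,
          (ZMod.stdAddChar ((m : ZMod c) * x) : ℂ) * ((ZMod.stdAddChar x⁻¹ : ℂ) ^ n * g n)‖ :=
        norm_sum_le _ _
    _ ≤ ∑ x ∈ U, (((min (x⁻¹).val (c - (x⁻¹).val) : ℕ) : ℝ))⁻¹ *
          (π * (3 + 2 * Λ) * Real.sqrt m) := Finset.sum_le_sum hterm
    _ = (∑ x ∈ U, (((min (x⁻¹).val (c - (x⁻¹).val) : ℕ) : ℝ))⁻¹) *
          (π * (3 + 2 * Λ) * Real.sqrt m) := by rw [Finset.sum_mul]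
    _ ≤ (2 * (1 + Real.log c)) * (π * (3 + 2 * Λ) * Real.sqrt m) :=
        mul_le_mul_of_nonneg_right (sum_units_inv_min_le hc hUmem) (by positivity)
    _ = 2 * π * (3 + 2 * Λ) * (1 + Real.log c) * Real.sqrt m := by ring

end Literature.NumberTheory.LFunctions.Bettin2017

end
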